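import Literature.Computability.MetaComplexity.RefutationCNF
import Literature.Computability.MetaComplexity.RefutationCNFUpperDefs
import Literature.Computability.MetaComplexity.ResolutionWidth
import HarnessLib

/-!
# Pudlák's refutation of `RREF(F,s)`: the axioms of `RREF(F,s)` as set-clauses

Towards the upper bound [Atserias–Müller 2020, Lemma 11] (`rrefCNF_upperBound` of
`RefutationCNF.lean`): the explicit Resolution refutation of `RREF(F,s)` from a satisfying
assignment of `F` operates on set-clauses (`Finset (Literal RefVar)`) and downloads the clauses
(A1)–(A4), (A9), (A11)–(A24) of `RREF(F,s) = RefCNF.rref X F s` as axioms. This file records,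
family by family, that the relevant set-clauses belong to `clauseSet (RefCNF.rref X F s)`
(lemmas `RefCNF.Pudlak.ax1`, …, `RefCNF.Pudlak.ax24`), in the form in which the refutation uses
them: the clauses mentioning a premise pointer come in an `L`-version and an `R`-version, selected
by `RefCNF.Pudlak.side b` of `RefutationCNFUpperDefs.lean` (`b = true`: the left pointer `L`, used when `α(X_i) = 1`; `b = false`:
the right pointer `R`, used when `α(X_i) = 0`), exactly as in the case distinction
"We treat the case `α(X_i) = 1`, the case `α(X_i) = 0` is analogous" of [AM20, proof of Lemma 11].

## References

* A. Atserias, M. Müller, *Automating Resolution is NP-hard*, J. ACM 67(5) (2020), Art. 31;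
  arXiv:1904.02991, §5, proof of Lemma 11; Appendix (clauses (A1)–(A24) of RREF).
-/

namespace Literature.Computability.MetaComplexity

open _root_.Computability Complexity

namespace RefCNF

namespace Pudlak

variable (X : List ℕ) (F : CNF ℕ) (s : ℕ)

/-- A list clause of `RREF(F,s)` is an axiom set-clause. [folklore] -/
theorem ax_of_mem {c : Clause RefVar} (h : c ∈ rref X F s) :
    c.toFinset ∈ clauseSet (rref X F s) :=
  mem_clauseSet_iff.2 ⟨c, h, rfl⟩

/-- Dispatching membership in `rref` to one of its 24 families. [folklore] -/
theorem mem_rref_iff (c : Clause RefVar) :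
    c ∈ rref X F s ↔
      c ∈ A1 true s X.length ∨ c ∈ A2 true s F.length ∨ c ∈ A3 true s ∨ c ∈ A4 true s ∨
      c ∈ A5 true s X.length ∨ c ∈ A6 true s F.length ∨ c ∈ A7 true s ∨ c ∈ A8 true s ∨
      c ∈ A9 true s ∨ c ∈ A10 true s ∨ c ∈ A11 true s ∨ c ∈ A12 true s ∨ c ∈ A13 true s ∨
      c ∈ A14 true s ∨ c ∈ A15 true s X.length ∨ c ∈ A16 true s X.length ∨
      c ∈ A17 true s X.length ∨ c ∈ A18 true s X.length ∨ c ∈ A19 true X F s ∨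
      c ∈ A20 true s X.length ∨ c ∈ A21 true s X.length ∨
      c ∈ A22 s ∨ c ∈ A23 s ∨ c ∈ A24 s := by
  simp only [rref_eq, blocks, List.mem_append, or_assoc]

/-! ### From a family to the whole formula -/

/-- Clauses of the family (A1) are clauses of `RREF(F,s)`. [cite: AtseriasMuller2020, Appendix (A1)] -/
theorem mem_rref_of_A1 {c : Clause RefVar} (h : c ∈ A1 true s X.length) : c ∈ rref X F s :=
  (mem_rref_iff X F s c).2 (by simp [h])

/-- Clauses of the family (A2) are clauses of `RREF(F,s)`. [cite: AtseriasMuller2020, Appendix (A2)] -/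
theorem mem_rref_of_A2 {c : Clause RefVar} (h : c ∈ A2 true s F.length) : c ∈ rref X F s :=
  (mem_rref_iff X F s c).2 (by simp [h])

/-- Clauses of the family (A3) are clauses of `RREF(F,s)`. [cite: AtseriasMuller2020, Appendix (A3)] -/
theorem mem_rref_of_A3 {c : Clause RefVar} (h : c ∈ A3 true s) : c ∈ rref X F s :=
  (mem_rref_iff X F s c).2 (by simp [h])

/-- Clauses of the family (A4) are clauses of `RREF(F,s)`. [cite: AtseriasMuller2020, Appendix (A4)] -/
theorem mem_rref_of_A4 {c : Clause RefVar} (h : c ∈ A4 true s) : c ∈ rref X F s :=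
  (mem_rref_iff X F s c).2 (by simp [h])

/-- Clauses of the family (A9) are clauses of `RREF(F,s)`. [cite: AtseriasMuller2020, Appendix (A9)] -/
theorem mem_rref_of_A9 {c : Clause RefVar} (h : c ∈ A9 true s) : c ∈ rref X F s :=
  (mem_rref_iff X F s c).2 (by simp [h])

/-- Clauses of the family (A11) are clauses of `RREF(F,s)`. [cite: AtseriasMuller2020, Appendix (A11)] -/
theorem mem_rref_of_A11 {c : Clause RefVar} (h : c ∈ A11 true s) : c ∈ rref X F s :=
  (mem_rref_iff X F s c).2 (by simp [h])

/-- Clauses of the family (A12) are clauses of `RREF(F,s)`. [cite: AtseriasMuller2020, Appendix (A12)] -/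
theorem mem_rref_of_A12 {c : Clause RefVar} (h : c ∈ A12 true s) : c ∈ rref X F s :=
  (mem_rref_iff X F s c).2 (by simp [h])

/-- Clauses of the family (A13) are clauses of `RREF(F,s)`. [cite: AtseriasMuller2020, Appendix (A13)] -/
theorem mem_rref_of_A13 {c : Clause RefVar} (h : c ∈ A13 true s) : c ∈ rref X F s :=
  (mem_rref_iff X F s c).2 (by simp [h])

/-- Clauses of the family (A14) are clauses of `RREF(F,s)`. [cite: AtseriasMuller2020, Appendix (A14)] -/
theorem mem_rref_of_A14 {c : Clause RefVar} (h : c ∈ A14 true s) : c ∈ rref X F s :=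
  (mem_rref_iff X F s c).2 (by simp [h])

/-- Clauses of the family (A15) are clauses of `RREF(F,s)`. [cite: AtseriasMuller2020, Appendix (A15)] -/
theorem mem_rref_of_A15 {c : Clause RefVar} (h : c ∈ A15 true s X.length) : c ∈ rref X F s :=
  (mem_rref_iff X F s c).2 (by simp [h])

/-- Clauses of the family (A16) are clauses of `RREF(F,s)`. [cite: AtseriasMuller2020, Appendix (A16)] -/
theorem mem_rref_of_A16 {c : Clause RefVar} (h : c ∈ A16 true s X.length) : c ∈ rref X F s :=
  (mem_rref_iff X F s c).2 (by simp [h])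

/-- Clauses of the family (A17) are clauses of `RREF(F,s)`. [cite: AtseriasMuller2020, Appendix (A17)] -/
theorem mem_rref_of_A17 {c : Clause RefVar} (h : c ∈ A17 true s X.length) : c ∈ rref X F s :=
  (mem_rref_iff X F s c).2 (by simp [h])

/-- Clauses of the family (A18) are clauses of `RREF(F,s)`. [cite: AtseriasMuller2020, Appendix (A18)] -/
theorem mem_rref_of_A18 {c : Clause RefVar} (h : c ∈ A18 true s X.length) : c ∈ rref X F s :=
  (mem_rref_iff X F s c).2 (by simp [h])

/-- Clauses of the family (A19) are clauses of `RREF(F,s)`. [cite: AtseriasMuller2020, Appendix (A19)] -/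
theorem mem_rref_of_A19 {c : Clause RefVar} (h : c ∈ A19 true X F s) : c ∈ rref X F s :=
  (mem_rref_iff X F s c).2 (by simp [h])

/-- Clauses of the family (A20) are clauses of `RREF(F,s)`. [cite: AtseriasMuller2020, Appendix (A20)] -/
theorem mem_rref_of_A20 {c : Clause RefVar} (h : c ∈ A20 true s X.length) : c ∈ rref X F s :=
  (mem_rref_iff X F s c).2 (by simp [h])

/-- Clauses of the family (A21) are clauses of `RREF(F,s)`. [cite: AtseriasMuller2020, Appendix (A21)] -/
theorem mem_rref_of_A21 {c : Clause RefVar} (h : c ∈ A21 true s X.length) : c ∈ rref X F s :=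
  (mem_rref_iff X F s c).2 (by simp [h])

/-- Clauses of the family (A22) are clauses of `RREF(F,s)`. [cite: AtseriasMuller2020, Appendix (A22)] -/
theorem mem_rref_of_A22 {c : Clause RefVar} (h : c ∈ A22 s) : c ∈ rref X F s :=
  (mem_rref_iff X F s c).2 (by simp [h])

/-- Clauses of the family (A23) are clauses of `RREF(F,s)`. [cite: AtseriasMuller2020, Appendix (A23)] -/
theorem mem_rref_of_A23 {c : Clause RefVar} (h : c ∈ A23 s) : c ∈ rref X F s :=
  (mem_rref_iff X F s c).2 (by simp [h])

/-- Clauses of the family (A24) are clauses of `RREF(F,s)`. [cite: AtseriasMuller2020, Appendix (A24)] -/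
theorem mem_rref_of_A24 {c : Clause RefVar} (h : c ∈ A24 s) : c ∈ rref X F s :=
  (mem_rref_iff X F s c).2 (by simp [h])

/-! ### The definedness clauses (A1)–(A4) -/

/-- (A1) as an axiom: `¬P[u] ∨ V[u,0] ∨ ⋯ ∨ V[u,n]`. [cite: AtseriasMuller2020, Appendix (A1)] -/
theorem ax1 {u : ℕ} (hu : u < s) :
    (pfx true u ++ (optRange X.length).map fun i => (RefVar.V u i, true)).toFinset ∈
      clauseSet (rref X F s) :=
  ax_of_mem X F s (mem_rref_of_A1 X F s (List.mem_map.2 ⟨u, List.mem_range.2 hu, rfl⟩))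

/-- (A2) as an axiom: `¬P[u] ∨ I[u,0] ∨ ⋯ ∨ I[u,m]`. [cite: AtseriasMuller2020, Appendix (A2)] -/
theorem ax2 {u : ℕ} (hu : u < s) :
    (pfx true u ++ (optRange F.length).map fun j => (RefVar.I u j, true)).toFinset ∈
      clauseSet (rref X F s) :=
  ax_of_mem X F s (mem_rref_of_A2 X F s (List.mem_map.2 ⟨u, List.mem_range.2 hu, rfl⟩))

/-- (A3)/(A4) as an axiom: `¬P[u] ∨ S[u,0] ∨ ⋯ ∨ S[u,s]` for the pointer `S = side b`.
[cite: AtseriasMuller2020, Appendix (A3), (A4)] -/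
theorem ax34 (b : Bool) {u : ℕ} (hu : u < s) :
    (pfx true u ++ (optRange s).map fun v => (side b u v, true)).toFinset ∈
      clauseSet (rref X F s) := by
  cases b
  · exact ax_of_mem X F s (mem_rref_of_A4 X F s (List.mem_map.2 ⟨u, List.mem_range.2 hu, rfl⟩))
  · exact ax_of_mem X F s (mem_rref_of_A3 X F s (List.mem_map.2 ⟨u, List.mem_range.2 hu, rfl⟩))

/-! ### The structural clauses (A9), (A11)–(A14) -/

/-- (A9) as an axiom: `¬P[u] ∨ ¬I[u,0] ∨ ¬V[u,0]`. [cite: AtseriasMuller2020, Appendix (A9)] -/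
theorem ax9 {u : ℕ} (hu : u < s) :
    ({(RefVar.P u, false), (RefVar.I u none, false), (RefVar.V u none, false)} :
      Finset (Literal RefVar)) ∈ clauseSet (rref X F s) := by
  have h : pfx true u ++ [(RefVar.I u none, false), (RefVar.V u none, false)] ∈ rref X F s :=
    mem_rref_of_A9 X F s (List.mem_map.2 ⟨u, List.mem_range.2 hu, rfl⟩)
  simpa [pfx] using ax_of_mem X F s h

/-- (A11)/(A12) as an axiom: `¬P[u] ∨ ¬I[u,0] ∨ ¬S[u,0]` for `S = side b`.
[cite: AtseriasMuller2020, Appendix (A11), (A12)] -/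
theorem ax1112 (b : Bool) {u : ℕ} (hu : u < s) :
    ({(RefVar.P u, false), (RefVar.I u none, false), (side b u none, false)} :
      Finset (Literal RefVar)) ∈ clauseSet (rref X F s) := by
  have h : pfx true u ++ [(RefVar.I u none, false), (side b u none, false)] ∈ rref X F s := by
    cases b
    · exact mem_rref_of_A12 X F s (List.mem_map.2 ⟨u, List.mem_range.2 hu, rfl⟩)
    · exact mem_rref_of_A11 X F s (List.mem_map.2 ⟨u, List.mem_range.2 hu, rfl⟩)
  simpa [pfx] using ax_of_mem X F s h

/-- (A13)/(A14) as an axiom: `¬P[u] ∨ ¬S[u,v]` for `u ≤ v < s` and `S = side b` (premises are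
earlier lines). [cite: AtseriasMuller2020, Appendix (A13), (A14)] -/
theorem ax1314 (b : Bool) {u v : ℕ} (huv : u ≤ v) (hv : v < s) :
    ({(RefVar.P u, false), (side b u (some v), false)} : Finset (Literal RefVar)) ∈
      clauseSet (rref X F s) := by
  have hu : u < s := lt_of_le_of_lt huv hv
  have hv' : v ∈ (List.range s).filter (u ≤ ·) :=
    List.mem_filter.2 ⟨List.mem_range.2 hv, by simpa using huv⟩
  have h : pfx true u ++ [(side b u (some v), false)] ∈ rref X F s := by
    cases b
    · exact mem_rref_of_A14 X F s
        (List.mem_flatMap.2 ⟨u, List.mem_range.2 hu, List.mem_map.2 ⟨v, hv', rfl⟩⟩)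
    · exact mem_rref_of_A13 X F s
        (List.mem_flatMap.2 ⟨u, List.mem_range.2 hu, List.mem_map.2 ⟨v, hv', rfl⟩⟩)
  simpa [pfx] using ax_of_mem X F s h

/-! ### The inference clauses (A15)–(A18) -/

/-- (A15)/(A16) as an axiom: `¬P[u] ∨ ¬P[v] ∨ ¬S[u,v] ∨ ¬V[u,i] ∨ D[v,i,¬b]` for `S = side b`
(the `b`-side premise of a cut on `X_i` contains the literal `X_i^{(1-b)}`).
[cite: AtseriasMuller2020, Appendix (A15), (A16)] -/
theorem ax1516 (b : Bool) {u v i : ℕ} (hu : u < s) (hv : v < s) (hi : i < X.length) :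
    ({(RefVar.P u, false), (RefVar.P v, false), (side b u (some v), false),
        (RefVar.V u (some i), false), (RefVar.D v i (!b), true)} : Finset (Literal RefVar)) ∈
      clauseSet (rref X F s) := by
  have h : pfx true u ++ pfx true v ++ [(side b u (some v), false),
      (RefVar.V u (some i), false), (RefVar.D v i (!b), true)] ∈ rref X F s := by
    cases b
    · exact mem_rref_of_A16 X F s (List.mem_flatMap.2 ⟨u, List.mem_range.2 hu,
        List.mem_flatMap.2 ⟨v, List.mem_range.2 hv, List.mem_map.2 ⟨i, List.mem_range.2 hi, rfl⟩⟩⟩)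
    · exact mem_rref_of_A15 X F s (List.mem_flatMap.2 ⟨u, List.mem_range.2 hu,
        List.mem_flatMap.2 ⟨v, List.mem_range.2 hv, List.mem_map.2 ⟨i, List.mem_range.2 hi, rfl⟩⟩⟩)
  simpa [pfx] using ax_of_mem X F s h

/-- (A17)/(A18) as an axiom: `¬P[u] ∨ ¬P[v] ∨ ¬S[u,v] ∨ ¬V[u,i] ∨ ¬D[v,i',b'] ∨ D[u,i',b']` for
`i' ≠ i` and `S = side b` (side literals of the `b`-side premise are kept).
[cite: AtseriasMuller2020, Appendix (A17), (A18)] -/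
theorem ax1718 (b : Bool) {u v i i' : ℕ} (hu : u < s) (hv : v < s) (hi : i < X.length)
    (hi' : i' < X.length) (hne : i' ≠ i) (b' : Bool) :
    ({(RefVar.P u, false), (RefVar.P v, false), (side b u (some v), false),
        (RefVar.V u (some i), false), (RefVar.D v i' b', false), (RefVar.D u i' b', true)} :
        Finset (Literal RefVar)) ∈ clauseSet (rref X F s) := by
  have hb' : b' ∈ [false, true] := by cases b' <;> simp
  have hi'' : i' ∈ (List.range X.length).filter (· ≠ i) :=
    List.mem_filter.2 ⟨List.mem_range.2 hi', by simpa using hne⟩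
  have h : pfx true u ++ pfx true v ++ [(side b u (some v), false),
      (RefVar.V u (some i), false), (RefVar.D v i' b', false), (RefVar.D u i' b', true)] ∈
        rref X F s := by
    cases b
    · exact mem_rref_of_A18 X F s (List.mem_flatMap.2 ⟨u, List.mem_range.2 hu,
        List.mem_flatMap.2 ⟨v, List.mem_range.2 hv, List.mem_flatMap.2 ⟨i, List.mem_range.2 hi,
          List.mem_flatMap.2 ⟨i', hi'', List.mem_map.2 ⟨b', hb', rfl⟩⟩⟩⟩⟩)
    · exact mem_rref_of_A17 X F s (List.mem_flatMap.2 ⟨u, List.mem_range.2 hu,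
        List.mem_flatMap.2 ⟨v, List.mem_range.2 hv, List.mem_flatMap.2 ⟨i, List.mem_range.2 hi,
          List.mem_flatMap.2 ⟨i', hi'', List.mem_map.2 ⟨b', hb', rfl⟩⟩⟩⟩⟩)
  simpa [pfx] using ax_of_mem X F s h

/-! ### The axiom clauses (A19)–(A21) and the activity clauses (A22)–(A24) -/

/-- (A19) as an axiom: `¬P[u] ∨ ¬I[u,j] ∨ D[u,i,b]` for a literal `X_i^{(b)}` of `C_j`, here the
literal `l` of the list clause `F[j]`. [cite: AtseriasMuller2020, Appendix (A19)] -/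
theorem ax19 {u j : ℕ} (hu : u < s) (hj : j < F.length) {l : Literal ℕ} (hl : l ∈ F[j]) :
    ({(RefVar.P u, false), (RefVar.I u (some j), false), (RefVar.D u (X.idxOf l.1) l.2, true)} :
      Finset (Literal RefVar)) ∈ clauseSet (rref X F s) := by
  have hl' : l ∈ F.getD j [] := by
    rw [List.getD_eq_getElem?_getD, List.getElem?_eq_getElem hj]; simpa using hl
  have h : pfx true u ++ [(RefVar.I u (some j), false), (RefVar.D u (X.idxOf l.1) l.2, true)] ∈
      rref X F s :=
    mem_rref_of_A19 X F s (List.mem_flatMap.2 ⟨u, List.mem_range.2 hu,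
      List.mem_flatMap.2 ⟨j, List.mem_range.2 hj, List.mem_map.2 ⟨l, hl', rfl⟩⟩⟩)
  simpa [pfx] using ax_of_mem X F s h

/-- (A20) as an axiom: `¬P[u] ∨ ¬D[u,i,0] ∨ ¬D[u,i,1]`. [cite: AtseriasMuller2020, Appendix (A20)]
-/
theorem ax20 {u i : ℕ} (hu : u < s) (hi : i < X.length) :
    ({(RefVar.P u, false), (RefVar.D u i false, false), (RefVar.D u i true, false)} :
      Finset (Literal RefVar)) ∈ clauseSet (rref X F s) := by
  have h : pfx true u ++ [(RefVar.D u i false, false), (RefVar.D u i true, false)] ∈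
      rref X F s :=
    mem_rref_of_A20 X F s
      (List.mem_flatMap.2 ⟨u, List.mem_range.2 hu, List.mem_map.2 ⟨i, List.mem_range.2 hi, rfl⟩⟩)
  simpa [pfx] using ax_of_mem X F s h

/-- (A21) as an axiom: `¬P[t] ∨ ¬D[t,i,b]` for the last line `t` (`t + 1 = s`).
[cite: AtseriasMuller2020, Appendix (A21)] -/
theorem ax21 {t i : ℕ} (ht : t + 1 = s) (hi : i < X.length) (b : Bool) :
    ({(RefVar.P t, false), (RefVar.D t i b, false)} : Finset (Literal RefVar)) ∈
      clauseSet (rref X F s) := by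
  have hb : b ∈ [false, true] := by cases b <;> simp
  have ht' : t ∈ (List.range s).filter (· + 1 = s) :=
    List.mem_filter.2 ⟨List.mem_range.2 (by omega), by simpa using ht⟩
  have h : pfx true t ++ [(RefVar.D t i b, false)] ∈ rref X F s :=
    mem_rref_of_A21 X F s (List.mem_flatMap.2 ⟨t, ht',
      List.mem_flatMap.2 ⟨i, List.mem_range.2 hi, List.mem_map.2 ⟨b, hb, rfl⟩⟩⟩)
  simpa [pfx] using ax_of_mem X F s h

/-- (A22)/(A23) as an axiom: `¬P[u] ∨ ¬S[u,v] ∨ P[v]` for `S = side b` (premises of active lines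
are active). [cite: AtseriasMuller2020, Appendix (A22), (A23)] -/
theorem ax2223 (b : Bool) {u v : ℕ} (hu : u < s) (hv : v < s) :
    ({(RefVar.P u, false), (side b u (some v), false), (RefVar.P v, true)} :
      Finset (Literal RefVar)) ∈ clauseSet (rref X F s) := by
  have h : [(RefVar.P u, false), (side b u (some v), false), (RefVar.P v, true)] ∈ rref X F s := by
    cases b
    · exact mem_rref_of_A23 X F s
        (List.mem_flatMap.2 ⟨u, List.mem_range.2 hu, List.mem_map.2 ⟨v, List.mem_range.2 hv, rfl⟩⟩)
    · exact mem_rref_of_A22 X F s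
        (List.mem_flatMap.2 ⟨u, List.mem_range.2 hu, List.mem_map.2 ⟨v, List.mem_range.2 hv, rfl⟩⟩)
  simpa using ax_of_mem X F s h

/-- (A24) as an axiom: `P[t]` for the last line `t` (`t + 1 = s`).
[cite: AtseriasMuller2020, Appendix (A24)] -/
theorem ax24 {t : ℕ} (ht : t + 1 = s) :
    ({(RefVar.P t, true)} : Finset (Literal RefVar)) ∈ clauseSet (rref X F s) := by
  have ht' : t ∈ (List.range s).filter (· + 1 = s) :=
    List.mem_filter.2 ⟨List.mem_range.2 (by omega), by simpa using ht⟩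
  have h : [(RefVar.P t, true)] ∈ rref X F s :=
    mem_rref_of_A24 X F s (List.mem_map.2 ⟨t, ht', rfl⟩)
  simpa using ax_of_mem X F s h

end Pudlak

end RefCNF

end Literature.Computability.MetaComplexity
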